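import Mathlib
import Literature.MathematicalPhysics.QuantumFieldTheory.Balaban1983to89.B5Ineq167LowerZd

/-!
# Bałaban [B5] (1.67), RIGHT half, scalar, whole lattice `ℤ^d`: `⟨B, Δ_kB⟩ ≤ γ₁⟨∂₁B, ∂₁B⟩` with an explicit
# `γ₁ = γ₁(d) = 2 + 8d²·36^d`, through a Fourier-free right inverse of block averaging — hence (1.67) in full on `ℤ^d`

**Source (verbatim; the quotation LOCATES the inequality — nothing printed is used as a hypothesis).**
[B5] = T. Bałaban, *Propagators and renormalization transformations for lattice gauge theories. I*, Commun. Math.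
Phys. **95** (1984) 17–40 [`Balaban1984PropagatorsI`], p. 29 [PDF 13] (render
`b2b-balaban-ref1/pages/1984-cmp95-propagators-rt-I/…-p013-x2.png`, read as an image by the author of this file),
(1.65): «The action Δ_k is thus defined by ⟨B, Δ_kB⟩ = ⟨∂H_kB, ∂H_kB⟩.»; after (1.66): «The function under the
integral is bounded from below and above by positive constants γ₀, γ₁ dependent on d only, so we have
γ₀⟨∂₁B, ∂₁B⟩ ≦ ⟨B, Δ_kB⟩ ≦ γ₁⟨∂₁B, ∂₁B⟩. (1.67)»; same page, top: «H_kB is a minimum of ½⟨∂A, ∂A⟩ on the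
hyperplane {A : Q_kA = B, R∂*A = 0}».  The paper obtains (1.67) from the momentum representation (1.66); the proof
below does NOT use (1.66): it tests the minimality of `H_kB` against an explicit real-space competitor.

**What is proved here (zero `sorry`; every `d`, every block side `n + 1 ≥ 1`, every `a > 0`).**  The objects are
those of this seat's nodes 3–9 (`B6QGQLower276`, `B5Hk103ScalarZd`, `B5Hk103Unique`, `B5Hk103Minimizer`,
`B5Hk165ActionZd`, `B5Ineq167LowerZd`): the SCALAR analogue on the WHOLE fine lattice `ℤ^d` (sites
`X d = Fin d → ℤ`, blocks `B n y` of side `n + 1` labelled by `y ∈ ℤ^d`, plain block sums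
`Σ_{p ∈ B(y)} A(p) = (n+1)^d·B(y)` for «Q'A = B»), the Dirichlet form `energy A = Σ_μ Σ'_p (A(p) − A(p + e_μ))²`
(`B5Hk103Minimizer.energy`; on the unit lattice `⟨∂₁B, ∂₁B⟩ = energy B`), the minimiser `HB` (node 7) and the
coarse action form `actionForm n a T B` of node 8 (= `⟨B, Δ_kB⟩` of (1.65) in the scalar dictionary
«⟨∂A, ∂A⟩ = η^{d−2}·energy A, η = (n+1)⁻¹», by `B5Hk165ActionZd.energy_HB_eq'`).
* §1 [folklore] lattice bookkeeping: crossing a block face (`blk_add_e_of_eq`, `blkConst_step`), the sliding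
  window `blk(r − t·e_k) ∈ {blk r, blk r − e_k}` for `0 ≤ t ≤ n` (`blk_sub_smul`), and FACE COUNTING on the cube
  (`card_filter_coord_le`: a one-coordinate condition with at most one solution selects at most `(n+1)^{d−1}`
  points of `{0,…,n}^d`; `card_face_block_le`, `card_face_window_le`).
* §2 [folklore] **the box-smoothed block-constant interpolant `A₁ = box ∗ (B ∘ blk)`**,
  `A₁(p) = (n+1)^{−d} Σ_{q ∈ {0..n}^d} B(blk(p − q))`: its fine gradient is the box average of the face profile
  `G_μ = 1[loc_μ = n]·(∇_μB ∘ blk)²`-carrier (`A1_step`), whence by Cauchy–Schwarz over the `(n+1)^{d−1}` face offsets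
  and block resummation **`dir_energy_A1_le`: `(n+1)²·Σ'_p (A₁(p) − A₁(p+e_μ))² ≤ (n+1)^d·Σ'_y (B(y) − B(y+e_μ))²`**
  — `‖∂^η A₁‖ ≤ ‖∂₁B‖` with constant exactly `1`.
* §3 [folklore] **the defect of the block means**, `D = B − Q′A₁`: `D(y)` is a double box average of the increments
  `B(blk p) − B(blk(p − q))` (`defect_eq`), each of which telescopes along the coordinates of the offset `q` into at
  most `d` single coarse bonds (`telescope`, `step_sq_le` by the sliding window), whence
  **`tsum_defect_sq_le`: `Σ'_y D(y)² ≤ d·energy B`** (`tsum_transport`: shift / block-sum / shift invariance of `Σ'`).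
* §4 [folklore] **the bump correction** `F_Λ(p) = Λ(blk p)·bump(p)` of node 3 (`B6QGQLower276.F`, `bump`,
  `F_step_sq`, `sum_B_bump = Θ₁^d`, `Θ₁/(n+1) ≥ 1/6`): block sums `Σ_{B(y)} F_Λ = Λ(y)Θ₁^d` (`sum_B_F`) and
  **`dir_energy_F_le`: `(n+1)²·Σ'_p (F_Λ(p) − F_Λ(p+e_μ))² ≤ 4(n+1)^d·Σ'_y Λ(y)²`**.
* §5 **the competitor `A = A₁ + F_Λ`, `Λ = ((n+1)/Θ₁)^d·D`** — an explicit, finitely supported, Fourier-free right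
  inverse of block averaging at `B` (`sum_B_competitor`: `Q′A = B` exactly) with
  `(n+1)²·energy A ≤ (2 + 8d²·36^d)·(n+1)^d·energy B` (`energy_competitor_le`); node 7's global minimality
  `energy_HB_le` then gives `energy_HB_le_gamma1`, and node 8's (1.65) identity gives
  **`ineq167_upper_scalar` — (1.67), RIGHT HALF, scalar, `ℤ^d`: `actionForm n a T B ≤ γ₁(d)·energy B`,
  `γ₁(d) = gamma1 d = 2 + 8d²·36^d`** for every finitely supported coarse field `B`, every `n`, every `a > 0`;
  with node 9's left half (`γ₀ = 1`): **`ineq167_scalar` — (1.67) IN FULL on `ℤ^d`**, and the printed shape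
  «∃ γ₀, γ₁ > 0 dependent on d only» as the closed statement `ineq167_scalar_exists`.

RELATION TO THE TREE (by name; nothing is imported from `Beta/` or from the torus line).
`Beta.Ineq167OperatorUpper.ineq167_DelK` (unit b2b-balaban-beta-an5) proves (1.67) in full for the GENUINE vector
operator `Δ_k` of (1.65) on finite tori, the upper half through a FOURIER-side right inverse of `Q_k` (the
central-alias lift, `γ₁ = (π²/4)^{d+2}`); `B5Bounds167Lattice.ineq167` (pv15) proves (1.67) for the form DEFINED by
the momentum representation (1.66).  The present file is the scalar, infinite-volume (`ℤ^d`, `Σ'`) statement for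
the (1.65)-defined form, with a REAL-SPACE competitor (no Fourier analysis, no (1.66), no `π`): it closes the
two-sided (1.67) of the whole-lattice scalar line of nodes 5–9.  The competitor is the scalar shadow of an
interpolating right inverse of `Q_k`; its ingredients (box filter, block bump) are tree objects of node 3.

HONEST SCOPE.  (i) SCALAR analogue (plain block means; no gauge condition `R∂*A = 0`, no vector indices, no
plaquette curl); (ii) WHOLE lattice `ℤ^d`, infinite volume, finitely supported coarse fields `B` (so that every `Σ'`
is a genuine sum; the constants do not see the support); (iii) `γ₁(d) = 2 + 8d²·36^d` is what this competitor
gives — the print asserts only the existence of `γ₁(d)`, and the optimal constant is much smaller; (iv) nothing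
here is the continuum limit, the torus statement, or progress on any summit: value = kernel discharge of one
printed-unproved inequality in the scalar infinite-volume setting.

ABSOLUTE-RULE CENSUS: every theorem below is proved outright from the tree modules named above and Mathlib
(sorry-free; axioms `propext`, `Classical.choice`, `Quot.sound` only); no quoted statement is used as a
hypothesis; the hypotheses of the headline theorems are `0 < a` and `supp B ⊆ T` (`T` a finset).  Unit
`b2b-balaban-pv23-g8` (surge node prover #23, gen 8; journal claim B5-167-UPPER-SCALAR-ZD); value = kernel
discharge (scalar, infinite volume), NOT summit progress.
-/

namespace Literature.MathematicalPhysics.QuantumFieldTheory.Balaban1983to89.B5Ineq167UpperZd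

open Finset Real Filter Topology
open B6QGQLower276 B6QGQDecay237 B5Hk103ScalarZd B5Hk103Unique B5Hk103Minimizer B5Hk165ActionZd
  B5Ineq167LowerZd

noncomputable section

variable {d : ℕ}

/-! ## §1  Lattice bookkeeping: crossing a face, the sliding window, face counting [folklore] -/

/-- Across a block face: `loc_μ p = n ⟹ blk (p + e_μ) = blk p + e_μ`. [folklore] -/
theorem blk_add_e_of_eq {n : ℕ} {p : X d} {μ : Fin d} (h : loc n p μ = n) :
    blk n (p + e μ) = blk n p + e μ := by
  have key := ediv_emod_add_one_of_eq (n := n) (x := p μ) h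
  funext ν
  by_cases hν : ν = μ
  · subst hν
    show (p + e ν) ν / side n = (blk n p + e ν) ν
    rw [add_e_apply_self, add_e_apply_self]
    exact key.1
  · show (p + e μ) ν / side n = (blk n p + e μ) ν
    rw [add_e_apply_ne p hν, add_e_apply_ne _ hν]
    rfl

/-- The fine forward difference of the block-constant lift `Bf ∘ blk` is the coarse forward difference on the
block faces `loc_μ = n` and zero elsewhere. [folklore] -/
theorem blkConst_step (n : ℕ) (Bf : X d → ℝ) (r : X d) (μ : Fin d) :
    Bf (blk n r) - Bf (blk n (r + e μ))
      = if loc n r μ = n then Bf (blk n r) - Bf (blk n r + e μ) else 0 := by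
  by_cases h : loc n r μ = n
  · rw [if_pos h, blk_add_e_of_eq h]
  · have hlt : loc n r μ < n := lt_of_le_of_ne (loc_le n r μ) h
    rw [if_neg h, (blk_add_e_of_lt hlt).1, sub_self]

/-- Sliding an integer down by `0 ≤ t ≤ n` changes its block quotient by `0` or `−1`. [folklore] -/
theorem ediv_sub_window {n : ℕ} (x t : ℤ) (ht0 : 0 ≤ t) (ht : t ≤ n) :
    (x - t) / side n = x / side n ∨ (x - t) / side n = x / side n - 1 := by
  have hs := (side_facts n).1
  have hsn : side n = n + 1 := rfl
  have h1 : (x - t) / side n ≤ x / side n := Int.ediv_le_ediv hs (by linarith)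
  have h2 : x / side n - 1 ≤ (x - t) / side n := by
    calc x / side n - 1 = (x + (-1) * side n) / side n := by
            rw [Int.add_mul_ediv_right _ _ hs.ne']; ring
      _ ≤ (x - t) / side n := Int.ediv_le_ediv hs (by linarith)
  omega

/-- `(r − t·e_k)(k) = r(k) − t`. [folklore] -/
theorem sub_smul_e_apply_self (r : X d) (t : ℤ) (k : Fin d) : (r - t • e k) k = r k - t := by
  simp [e]

/-- `(r − t·e_k)(ν) = r(ν)` for `ν ≠ k`. [folklore] -/
theorem sub_smul_e_apply_ne (r : X d) (t : ℤ) {k ν : Fin d} (h : ν ≠ k) : (r - t • e k) ν = r ν := by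
  simp [e, h]

/-- **Sliding window**: for `0 ≤ t ≤ n`, the block of `r − t·e_k` is the block of `r` or the one below it in
direction `k`. [folklore] -/
theorem blk_sub_smul (n : ℕ) (r : X d) (k : Fin d) {t : ℤ} (ht0 : 0 ≤ t) (ht : t ≤ n) :
    blk n (r - t • e k) = blk n r ∨ blk n (r - t • e k) = blk n r - e k := by
  rcases ediv_sub_window (n := n) (r k) t ht0 ht with h | h
  · left
    funext ν
    by_cases hν : ν = k
    · subst hν
      show (r - t • e ν) ν / side n = r ν / side n
      rw [sub_smul_e_apply_self]; exact h
    · show (r - t • e k) ν / side n = r ν / side n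
      rw [sub_smul_e_apply_ne r t hν]
  · right
    funext ν
    by_cases hν : ν = k
    · subst hν
      show (r - t • e ν) ν / side n = (blk n r - e ν) ν
      rw [sub_smul_e_apply_self]
      simp only [Pi.sub_apply, e, Pi.single_eq_same]
      exact h
    · show (r - t • e k) ν / side n = (blk n r - e k) ν
      rw [sub_smul_e_apply_ne r t hν]
      simp only [Pi.sub_apply, e, Pi.single_eq_of_ne hν, sub_zero]
      rfl

/-- The chart of a block is injective in the local coordinates. [folklore] -/
theorem chart_injective (n : ℕ) (y : X d) : Function.Injective (chart n y) :=
  fun _ _ h => (chart_inj h).2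

/-- **Face counting on the cube**: if a property of the `μ`-th local coordinate holds for at most one value, at
most `(n+1)^{d−1}` points of the cube `{0,…,n}^d` have it. [folklore] -/
theorem card_filter_coord_le (n : ℕ) (μ : Fin d) (P : Fin (n + 1) → Prop) [DecidablePred P]
    (hP : ∀ t t', P t → P t' → t = t') :
    (((Finset.univ : Finset (Fin d → Fin (n + 1))).filter fun z => P (z μ)).card : ℝ)
      ≤ ((n : ℝ) + 1) ^ (d - 1) := by
  classical
  have hP1 : (((Finset.univ : Finset (Fin (n + 1))).filter P).card : ℝ) ≤ 1 := by
    exact_mod_cast Finset.card_le_one.2 fun t ht t' ht' =>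
      hP t t' (Finset.mem_filter.1 ht).2 (Finset.mem_filter.1 ht').2
  -- the count as a sum of a product of one-coordinate indicators
  have h1 : (((Finset.univ : Finset (Fin d → Fin (n + 1))).filter fun z => P (z μ)).card : ℝ)
      = ∑ z : Fin d → Fin (n + 1), ∏ ν : Fin d, (if ν = μ then (if P (z ν) then (1 : ℝ) else 0) else 1) := by
    rw [Finset.card_filter]
    push_cast
    refine Finset.sum_congr rfl fun z _ => ?_
    rw [Finset.prod_ite_eq']
    simp
  rw [h1, ← Fintype.prod_sum fun (ν : Fin d) (t : Fin (n + 1)) =>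
    (if ν = μ then (if P t then (1 : ℝ) else 0) else 1)]
  -- bound factor by factor
  have hfac : ∀ ν : Fin d, ∑ t : Fin (n + 1), (if ν = μ then (if P t then (1 : ℝ) else 0) else 1)
      ≤ (if ν = μ then (1 : ℝ) else ((n : ℝ) + 1)) := by
    intro ν
    by_cases hν : ν = μ
    · simp only [hν, if_true]
      rw [← Finset.sum_filter, Finset.sum_const, nsmul_eq_mul, mul_one]
      exact hP1
    · simp only [hν, if_false, Finset.sum_const, Finset.card_univ, Fintype.card_fin, nsmul_eq_mul, mul_one]
      push_cast; exact le_rfl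
  have hnn : ∀ ν : Fin d, 0 ≤ ∑ t : Fin (n + 1), (if ν = μ then (if P t then (1 : ℝ) else 0) else 1) :=
    fun ν => Finset.sum_nonneg fun t _ => by split_ifs <;> norm_num
  calc ∏ ν : Fin d, ∑ t : Fin (n + 1), (if ν = μ then (if P t then (1 : ℝ) else 0) else 1)
      ≤ ∏ ν : Fin d, (if ν = μ then (1 : ℝ) else ((n : ℝ) + 1)) :=
        Finset.prod_le_prod (fun ν _ => hnn ν) fun ν _ => hfac ν
    _ = ((n : ℝ) + 1) ^ (d - 1) := by
        rw [← Finset.mul_prod_erase _ _ (Finset.mem_univ μ), if_pos rfl, one_mul]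
        rw [Finset.prod_congr rfl fun ν hν => if_neg (Finset.ne_of_mem_erase hν), Finset.prod_const,
          Finset.card_erase_of_mem (Finset.mem_univ μ), Finset.card_univ, Fintype.card_fin]

/-- At most `(n+1)^{d−1}` sites of a block lie on its upper face in direction `μ`. [folklore] -/
theorem card_face_block_le (n : ℕ) (y : X d) (μ : Fin d) :
    (((B n y).filter fun r => loc n r μ = n).card : ℝ) ≤ ((n : ℝ) + 1) ^ (d - 1) := by
  classical
  unfold B
  rw [Finset.filter_image, Finset.card_image_of_injective _ (chart_injective n y)]
  have hset : ((Finset.univ : Finset (Fin d → Fin (n + 1))).filter fun a => loc n (chart n y a) μ = n)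
      = (Finset.univ.filter fun z : Fin d → Fin (n + 1) => ((z μ : ℕ) : ℤ) = n) :=
    Finset.filter_congr fun z _ => by simp only [loc_chart]
  rw [hset]
  exact card_filter_coord_le n μ (fun t => ((t : ℕ) : ℤ) = n) fun t t' ht ht' => by
    apply Fin.ext; exact_mod_cast ht.trans ht'.symm

/-- In a window of `n + 1` consecutive integers at most one is `≡ n (mod n+1)`: uniqueness of the face offset.
[folklore] -/
theorem face_offset_unique {n : ℕ} (c : ℤ) {t t' : ℤ} (ht0 : 0 ≤ t) (ht : t ≤ n) (ht0' : 0 ≤ t')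
    (ht' : t' ≤ n) (h : (c - t) % side n = n) (h' : (c - t') % side n = n) : t = t' := by
  have key : ∀ u : ℤ, 0 ≤ u → u ≤ n → (c - u) % side n = n → u = (c % side n - n) % side n := by
    intro u hu0 hu hcu
    have hus : u < side n := by unfold side; omega
    calc u = u % side n := (Int.emod_eq_of_lt hu0 hus).symm
      _ = (c - (c - u)) % side n := by rw [sub_sub_cancel]
      _ = (c % side n - (c - u) % side n) % side n := Int.sub_emod _ _ _
      _ = (c % side n - n) % side n := by rw [hcu]
  rw [key t ht0 ht h, key t' ht0' ht' h']

/-- At most `(n+1)^{d−1}` offsets `q ∈ {0,…,n}^d` put `p − q` on an upper `μ`-face. [folklore] -/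
theorem card_face_window_le (n : ℕ) (p : X d) (μ : Fin d) :
    (((B n 0).filter fun q => loc n (p - q) μ = n).card : ℝ) ≤ ((n : ℝ) + 1) ^ (d - 1) := by
  classical
  unfold B
  rw [Finset.filter_image, Finset.card_image_of_injective _ (chart_injective n 0)]
  have hset : ((Finset.univ : Finset (Fin d → Fin (n + 1))).filter
        fun a => loc n (p - chart n (0 : X d) a) μ = n)
      = (Finset.univ.filter fun z : Fin d → Fin (n + 1) => (p μ - ((z μ : ℕ) : ℤ)) % side n = n) :=
    Finset.filter_congr fun z _ => by simp [loc, chart]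
  rw [hset]
  refine card_filter_coord_le n μ (fun t => (p μ - ((t : ℕ) : ℤ)) % side n = n) fun t t' ht ht' => ?_
  apply Fin.ext
  have h0 : (0 : ℤ) ≤ ((t : ℕ) : ℤ) := by positivity
  have h0' : (0 : ℤ) ≤ ((t' : ℕ) : ℤ) := by positivity
  have h1 : ((t : ℕ) : ℤ) ≤ n := by have := t.2; omega
  have h1' : ((t' : ℕ) : ℤ) ≤ n := by have := t'.2; omega
  exact_mod_cast face_offset_unique (p μ) h0 h1 h0' h1' ht ht'

/-- `(n+1)^{d−1}·(n+1) = (n+1)^d` for `d ≥ 1`. [folklore] -/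
theorem pow_pred_mul (n : ℕ) (μ : Fin d) :
    ((n : ℝ) + 1) ^ (d - 1) * ((n : ℝ) + 1) = ((n : ℝ) + 1) ^ d := by
  rw [← pow_succ, Nat.sub_add_cancel (Fin.pos μ)]

/-- A finitely supported coarse field is square summable. [folklore] -/
theorem summable_sq_of_support {T : Finset (X d)} {Bf : X d → ℝ} (hT : ∀ y ∉ T, Bf y = 0) :
    Summable fun y => Bf y ^ 2 :=
  summable_of_ne_finset_zero (s := T) fun y hy => by simp [hT y hy]

/-! ## §2  The box-smoothed block-constant interpolant `A₁` and its Dirichlet energy [folklore] -/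

/-- **`A₁ = box ∗ (B ∘ blk)`**: `A₁(p) = (n+1)^{−d} Σ_{q ∈ {0,…,n}^d} B(blk(p − q))` — the block-constant lift of the
coarse field `B`, smoothed by the box filter of one block (`{0,…,n}^d = B n 0`). [folklore] -/
def A1 (n : ℕ) (Bf : X d → ℝ) (p : X d) : ℝ :=
  (((n : ℝ) + 1) ^ d)⁻¹ * ∑ q ∈ B n (0 : X d), Bf (blk n (p - q))

/-- The face profile `G_μ(r) = 1[loc_μ r = n]·(B(blk r) − B(blk r + e_μ))²`. [folklore] -/
def faceSq (n : ℕ) (Bf : X d → ℝ) (μ : Fin d) (r : X d) : ℝ :=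
  if loc n r μ = n then (Bf (blk n r) - Bf (blk n r + e μ)) ^ 2 else 0

/-- `0 ≤ G_μ`. [folklore] -/
theorem faceSq_nonneg (n : ℕ) (Bf : X d → ℝ) (μ : Fin d) (r : X d) : 0 ≤ faceSq n Bf μ r := by
  unfold faceSq; split_ifs <;> positivity

/-- `G_μ(r) ≤ (B(blk r) − B(blk r + e_μ))²`. [folklore] -/
theorem faceSq_le (n : ℕ) (Bf : X d → ℝ) (μ : Fin d) (r : X d) :
    faceSq n Bf μ r ≤ (Bf (blk n r) - Bf (blk n r + e μ)) ^ 2 := by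
  unfold faceSq; split_ifs
  · exact le_rfl
  · positivity

/-- **The fine gradient of `A₁` is the box average of the face profile**:
`A₁(p) − A₁(p + e_μ) = (n+1)^{−d} Σ_q 1[loc_μ(p−q) = n]·(B(blk(p−q)) − B(blk(p−q) + e_μ))` (finite differences
commute with the box filter; `blkConst_step`). [folklore] -/
theorem A1_step (n : ℕ) (Bf : X d → ℝ) (p : X d) (μ : Fin d) :
    A1 n Bf p - A1 n Bf (p + e μ)
      = (((n : ℝ) + 1) ^ d)⁻¹ * ∑ q ∈ B n (0 : X d),
          (if loc n (p - q) μ = n then Bf (blk n (p - q)) - Bf (blk n (p - q) + e μ) else 0) := by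
  unfold A1
  rw [← mul_sub, ← Finset.sum_sub_distrib]
  congr 1
  refine Finset.sum_congr rfl fun q _ => ?_
  rw [add_sub_right_comm]
  exact blkConst_step n Bf (p - q) μ

/-- **Pointwise bound** (Cauchy–Schwarz over the at most `(n+1)^{d−1}` face offsets, `card_face_window_le`):
`(A₁(p) − A₁(p+e_μ))² ≤ (n+1)^{−2d}·(n+1)^{d−1}·Σ_{q} G_μ(p − q)`. [folklore] -/
theorem A1_step_sq_le (n : ℕ) (Bf : X d → ℝ) (p : X d) (μ : Fin d) :
    (A1 n Bf p - A1 n Bf (p + e μ)) ^ 2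
      ≤ ((((n : ℝ) + 1) ^ d)⁻¹ ^ 2 * ((n : ℝ) + 1) ^ (d - 1))
          * ∑ q ∈ B n (0 : X d), faceSq n Bf μ (p - q) := by
  classical
  rw [A1_step, mul_pow]
  set S := (B n (0 : X d)).filter fun q => loc n (p - q) μ = n with hS
  have hsum : ∑ q ∈ B n (0 : X d),
      (if loc n (p - q) μ = n then Bf (blk n (p - q)) - Bf (blk n (p - q) + e μ) else 0)
      = ∑ q ∈ S, (Bf (blk n (p - q)) - Bf (blk n (p - q) + e μ)) := by
    rw [hS, Finset.sum_filter]
  have hsq : ∑ q ∈ B n (0 : X d), faceSq n Bf μ (p - q)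
      = ∑ q ∈ S, (Bf (blk n (p - q)) - Bf (blk n (p - q) + e μ)) ^ 2 := by
    simp only [faceSq]
    rw [hS, Finset.sum_filter]
  rw [hsum, hsq, mul_assoc]
  refine mul_le_mul_of_nonneg_left ?_ (by positivity)
  calc (∑ q ∈ S, (Bf (blk n (p - q)) - Bf (blk n (p - q) + e μ))) ^ 2
      ≤ (S.card : ℝ) * ∑ q ∈ S, (Bf (blk n (p - q)) - Bf (blk n (p - q) + e μ)) ^ 2 := sq_sum_le S _
    _ ≤ ((n : ℝ) + 1) ^ (d - 1) * ∑ q ∈ S, (Bf (blk n (p - q)) - Bf (blk n (p - q) + e μ)) ^ 2 :=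
        mul_le_mul_of_nonneg_right (card_face_window_le n p μ)
          (Finset.sum_nonneg fun q _ => sq_nonneg _)

/-- The face profile of a square-summable coarse field is summable. [folklore] -/
theorem summable_faceSq (n : ℕ) {Bf : X d → ℝ} (hBf : Summable fun y => Bf y ^ 2) (μ : Fin d) :
    Summable (faceSq n Bf μ) := by
  have hg : Summable fun y => (Bf y - Bf (y + e μ)) ^ 2 := summable_grad_sq hBf μ
  have hgb : Summable fun r : X d => (Bf (blk n r) - Bf (blk n r + e μ)) ^ 2 :=
    summable_comp_blk n (G := fun y => (Bf y - Bf (y + e μ)) ^ 2) hg fun y => sq_nonneg _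
  exact Summable.of_nonneg_of_le (faceSq_nonneg n Bf μ) (faceSq_le n Bf μ) hgb

/-- Block by block: `Σ_{r ∈ B(y)} G_μ(r) ≤ (n+1)^{d−1}·(B(y) − B(y+e_μ))²` (`card_face_block_le`). [folklore] -/
theorem sum_B_faceSq_le (n : ℕ) (Bf : X d → ℝ) (μ : Fin d) (y : X d) :
    ∑ r ∈ B n y, faceSq n Bf μ r ≤ ((n : ℝ) + 1) ^ (d - 1) * (Bf y - Bf (y + e μ)) ^ 2 := by
  classical
  have : ∑ r ∈ B n y, faceSq n Bf μ r
      = ∑ _r ∈ (B n y).filter (fun r => loc n r μ = n), (Bf y - Bf (y + e μ)) ^ 2 := by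
    rw [Finset.sum_filter]
    refine Finset.sum_congr rfl fun r hr => ?_
    simp only [faceSq, mem_B.1 hr]
  rw [this, Finset.sum_const, nsmul_eq_mul]
  exact mul_le_mul_of_nonneg_right (card_face_block_le n y μ) (sq_nonneg _)

/-- `Σ'_r G_μ(r) ≤ (n+1)^{d−1}·Σ'_y (B(y) − B(y+e_μ))²`. [folklore] -/
theorem tsum_faceSq_le (n : ℕ) {Bf : X d → ℝ} (hBf : Summable fun y => Bf y ^ 2) (μ : Fin d) :
    ∑' r, faceSq n Bf μ r ≤ ((n : ℝ) + 1) ^ (d - 1) * ∑' y, (Bf y - Bf (y + e μ)) ^ 2 := by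
  have hG := summable_faceSq n hBf μ
  have hg : Summable fun y => (Bf y - Bf (y + e μ)) ^ 2 := summable_grad_sq hBf μ
  rw [← tsum_blocks n hG, ← tsum_mul_left]
  exact (summable_blocks n hG).tsum_le_tsum (sum_B_faceSq_le n Bf μ) (hg.mul_left _)

/-- The finite set carrying `A₁` when `B` is supported in `T`: `U(T) + {0,…,n}^d`. [folklore] -/
def suppA1 (n : ℕ) (T : Finset (X d)) : Finset (X d) :=
  ((U n T) ×ˢ (B n (0 : X d))).image fun x => x.1 + x.2

/-- `A₁` vanishes off `suppA1`. [folklore] -/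
theorem A1_eq_zero (n : ℕ) {T : Finset (X d)} {Bf : X d → ℝ} (hT : ∀ y ∉ T, Bf y = 0) {p : X d}
    (hp : p ∉ suppA1 n T) : A1 n Bf p = 0 := by
  classical
  unfold A1
  rw [Finset.sum_eq_zero, mul_zero]
  intro q hq
  apply hT
  intro hmem
  apply hp
  unfold suppA1
  rw [Finset.mem_image]
  exact ⟨(p - q, q), Finset.mem_product.2 ⟨mem_U.2 hmem, hq⟩, by simp⟩

/-- `A₁` is square summable (finitely supported). [folklore] -/
theorem summable_A1_sq (n : ℕ) {T : Finset (X d)} {Bf : X d → ℝ} (hT : ∀ y ∉ T, Bf y = 0) :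
    Summable fun p => A1 n Bf p ^ 2 :=
  summable_of_ne_finset_zero (s := suppA1 n T) fun p hp => by simp [A1_eq_zero n hT hp]

/-- **The Dirichlet energy of `A₁`, one direction**:
`(n+1)²·Σ'_p (A₁(p) − A₁(p+e_μ))² ≤ (n+1)^d·Σ'_y (B(y) − B(y+e_μ))²` — constant exactly `1`
(in the `η`-lattice normalisation: `‖∂^η_μ A₁‖² ≤ ‖∂¹_μ B‖²`). [folklore] -/
theorem dir_energy_A1_le (n : ℕ) {T : Finset (X d)} (Bf : X d → ℝ) (hT : ∀ y ∉ T, Bf y = 0)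
    (μ : Fin d) :
    ((n : ℝ) + 1) ^ 2 * ∑' p, (A1 n Bf p - A1 n Bf (p + e μ)) ^ 2
      ≤ ((n : ℝ) + 1) ^ d * ∑' y, (Bf y - Bf (y + e μ)) ^ 2 := by
  have hN0 : (0 : ℝ) < (n : ℝ) + 1 := by positivity
  have hBf := summable_sq_of_support hT
  have hG := summable_faceSq n hBf μ
  have hL : Summable fun p => (A1 n Bf p - A1 n Bf (p + e μ)) ^ 2 :=
    summable_grad_sq (summable_A1_sq n hT) μ
  have hRq : ∀ q ∈ B n (0 : X d), Summable fun p => faceSq n Bf μ (p - q) := fun q _ => by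
    simpa [sub_eq_add_neg] using summable_shift hG (-q)
  have hR : Summable fun p => ((((n : ℝ) + 1) ^ d)⁻¹ ^ 2 * ((n : ℝ) + 1) ^ (d - 1))
      * ∑ q ∈ B n (0 : X d), faceSq n Bf μ (p - q) :=
    (summable_sum hRq).mul_left _
  have h1 : ∑' p, (A1 n Bf p - A1 n Bf (p + e μ)) ^ 2
      ≤ ((((n : ℝ) + 1) ^ d)⁻¹ ^ 2 * ((n : ℝ) + 1) ^ (d - 1))
          * (((n : ℝ) + 1) ^ d * ∑' r, faceSq n Bf μ r) := by
    calc ∑' p, (A1 n Bf p - A1 n Bf (p + e μ)) ^ 2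
        ≤ ∑' p, ((((n : ℝ) + 1) ^ d)⁻¹ ^ 2 * ((n : ℝ) + 1) ^ (d - 1))
            * ∑ q ∈ B n (0 : X d), faceSq n Bf μ (p - q) :=
          hL.tsum_le_tsum (fun p => A1_step_sq_le n Bf p μ) hR
      _ = ((((n : ℝ) + 1) ^ d)⁻¹ ^ 2 * ((n : ℝ) + 1) ^ (d - 1))
            * ∑ q ∈ B n (0 : X d), ∑' p, faceSq n Bf μ (p - q) := by
          rw [tsum_mul_left, Summable.tsum_finsetSum hRq]
      _ = ((((n : ℝ) + 1) ^ d)⁻¹ ^ 2 * ((n : ℝ) + 1) ^ (d - 1))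
            * ∑ _q ∈ B n (0 : X d), ∑' r, faceSq n Bf μ r := by
          congr 1
          refine Finset.sum_congr rfl fun q _ => ?_
          simpa [sub_eq_add_neg] using tsum_shift (faceSq n Bf μ) (-q)
      _ = ((((n : ℝ) + 1) ^ d)⁻¹ ^ 2 * ((n : ℝ) + 1) ^ (d - 1))
            * (((n : ℝ) + 1) ^ d * ∑' r, faceSq n Bf μ r) := by rw [sum_B_const]
  have h2 := tsum_faceSq_le n hBf μ
  have hpow : ((n : ℝ) + 1) ^ (d - 1) = ((n : ℝ) + 1) ^ d / ((n : ℝ) + 1) := by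
    rw [← pow_pred_mul n μ]; field_simp
  calc ((n : ℝ) + 1) ^ 2 * ∑' p, (A1 n Bf p - A1 n Bf (p + e μ)) ^ 2
      ≤ ((n : ℝ) + 1) ^ 2 * (((((n : ℝ) + 1) ^ d)⁻¹ ^ 2 * ((n : ℝ) + 1) ^ (d - 1))
          * (((n : ℝ) + 1) ^ d * (((n : ℝ) + 1) ^ (d - 1) * ∑' y, (Bf y - Bf (y + e μ)) ^ 2))) := by
        refine mul_le_mul_of_nonneg_left (h1.trans ?_) (by positivity)
        exact mul_le_mul_of_nonneg_left (mul_le_mul_of_nonneg_left h2 (by positivity)) (by positivity)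
    _ = ((n : ℝ) + 1) ^ d * ∑' y, (Bf y - Bf (y + e μ)) ^ 2 := by
        rw [hpow]
        field_simp

/-! ## §3  The block means of `A₁`: the defect `D = B − Q′A₁` is `ℓ²`-small against the energy [folklore] -/

/-- The coarse gradient profile `g_μ(y) = (B(y) − B(y + e_μ))²`, so that `energy B = Σ_μ Σ'_y g_μ(y)`. [folklore] -/
def gsq (Bf : X d → ℝ) (μ : Fin d) (y : X d) : ℝ := (Bf y - Bf (y + e μ)) ^ 2

/-- `energy B = Σ_μ Σ'_y g_μ(y)`. [folklore] -/
theorem energy_eq_gsq (Bf : X d → ℝ) : energy Bf = ∑ μ : Fin d, ∑' y, gsq Bf μ y := rfl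

/-- Shift invariance of summability, subtractive form. [folklore] -/
theorem summable_shift_sub {g : X d → ℝ} (hg : Summable g) (v : X d) : Summable fun q => g (q - v) := by
  simpa only [sub_eq_add_neg] using summable_shift hg (-v)

/-- Shift invariance of `Σ'`, subtractive form. [folklore] -/
theorem tsum_shift_sub (g : X d → ℝ) (v : X d) : ∑' q, g (q - v) = ∑' q, g q := by
  simpa only [sub_eq_add_neg] using tsum_shift g (-v)

/-- **The defect** of the block means of `A₁`: `D(y) = B(y) − (n+1)^{−d} Σ_{p ∈ B(y)} A₁(p)` (`= (B − Q′A₁)(y)`).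
[folklore] -/
def defect (n : ℕ) (Bf : X d → ℝ) (y : X d) : ℝ :=
  Bf y - (((n : ℝ) + 1) ^ d)⁻¹ * ∑ p ∈ B n y, A1 n Bf p

/-- The defect as a double box average of coarse increments:
`D(y) = (n+1)^{−2d} Σ_{p ∈ B(y)} Σ_{q ∈ {0..n}^d} (B(blk p) − B(blk(p − q)))`. [folklore] -/
theorem defect_eq (n : ℕ) (Bf : X d → ℝ) (y : X d) :
    defect n Bf y = (((n : ℝ) + 1) ^ d)⁻¹ ^ 2 *
      ∑ p ∈ B n y, ∑ q ∈ B n (0 : X d), (Bf (blk n p) - Bf (blk n (p - q))) := by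
  have hN : ((n : ℝ) + 1) ^ d ≠ 0 := by positivity
  have h1 : ∑ p ∈ B n y, ∑ _q ∈ B n (0 : X d), Bf (blk n p)
      = ((n : ℝ) + 1) ^ d * (((n : ℝ) + 1) ^ d * Bf y) := by
    rw [← sum_B_const (n := n) y (((n : ℝ) + 1) ^ d * Bf y)]
    exact Finset.sum_congr rfl fun p hp => by rw [sum_B_const, mem_B.1 hp]
  unfold defect A1
  rw [← Finset.mul_sum]
  simp_rw [Finset.sum_sub_distrib]
  rw [h1]
  field_simp

/-- Jensen / Cauchy–Schwarz twice: `D(y)² ≤ (n+1)^{−2d} Σ_{p ∈ B(y)} Σ_q (B(blk p) − B(blk(p − q)))²`. [folklore] -/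
theorem defect_sq_le (n : ℕ) (Bf : X d → ℝ) (y : X d) :
    defect n Bf y ^ 2 ≤ (((n : ℝ) + 1) ^ d)⁻¹ ^ 2 *
      ∑ p ∈ B n y, ∑ q ∈ B n (0 : X d), (Bf (blk n p) - Bf (blk n (p - q))) ^ 2 := by
  have hN : ((n : ℝ) + 1) ^ d ≠ 0 := by positivity
  rw [defect_eq, mul_pow]
  have hcs : (∑ p ∈ B n y, ∑ q ∈ B n (0 : X d), (Bf (blk n p) - Bf (blk n (p - q)))) ^ 2
      ≤ ((n : ℝ) + 1) ^ d * (((n : ℝ) + 1) ^ d *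
          ∑ p ∈ B n y, ∑ q ∈ B n (0 : X d), (Bf (blk n p) - Bf (blk n (p - q))) ^ 2) := by
    calc (∑ p ∈ B n y, ∑ q ∈ B n (0 : X d), (Bf (blk n p) - Bf (blk n (p - q)))) ^ 2
        ≤ ((B n y).card : ℝ) *
            ∑ p ∈ B n y, (∑ q ∈ B n (0 : X d), (Bf (blk n p) - Bf (blk n (p - q)))) ^ 2 :=
          sq_sum_le _ _
      _ ≤ ((B n y).card : ℝ) * ∑ p ∈ B n y, (((B n (0 : X d)).card : ℝ) *
            ∑ q ∈ B n (0 : X d), (Bf (blk n p) - Bf (blk n (p - q))) ^ 2) :=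
          mul_le_mul_of_nonneg_left (Finset.sum_le_sum fun p _ => sq_sum_le _ _) (by positivity)
      _ = ((n : ℝ) + 1) ^ d * (((n : ℝ) + 1) ^ d *
            ∑ p ∈ B n y, ∑ q ∈ B n (0 : X d), (Bf (blk n p) - Bf (blk n (p - q))) ^ 2) := by
          rw [card_B, card_B, ← Finset.mul_sum]
  calc ((((n : ℝ) + 1) ^ d)⁻¹ ^ 2) ^ 2 *
        (∑ p ∈ B n y, ∑ q ∈ B n (0 : X d), (Bf (blk n p) - Bf (blk n (p - q)))) ^ 2
      ≤ ((((n : ℝ) + 1) ^ d)⁻¹ ^ 2) ^ 2 * (((n : ℝ) + 1) ^ d * (((n : ℝ) + 1) ^ d *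
          ∑ p ∈ B n y, ∑ q ∈ B n (0 : X d), (Bf (blk n p) - Bf (blk n (p - q))) ^ 2)) :=
        mul_le_mul_of_nonneg_left hcs (by positivity)
    _ = (((n : ℝ) + 1) ^ d)⁻¹ ^ 2 *
          ∑ p ∈ B n y, ∑ q ∈ B n (0 : X d), (Bf (blk n p) - Bf (blk n (p - q))) ^ 2 := by
        field_simp

/-- Partial offsets: the first `k` coordinates of `q`. [folklore] -/
def pref (q : X d) (k : ℕ) : X d := fun ν => if (ν : ℕ) < k then q ν else 0

/-- `pref q 0 = 0`. [folklore] -/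
theorem pref_zero (q : X d) : pref q 0 = 0 := by
  funext ν; simp [pref]

/-- `pref q k = q` for `k ≥ d`. [folklore] -/
theorem pref_of_le (q : X d) {k : ℕ} (hk : d ≤ k) : pref q k = q := by
  funext ν; simp [pref, lt_of_lt_of_le ν.2 hk]

/-- One more coordinate: `pref q (μ+1) = pref q μ + q_μ e_μ`. [folklore] -/
theorem pref_succ (q : X d) (μ : Fin d) : pref q ((μ : ℕ) + 1) = pref q μ + q μ • e μ := by
  funext ν
  simp only [pref, Pi.add_apply, Pi.smul_apply, e, smul_eq_mul]
  by_cases h : ν = μ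
  · subst h; simp
  · have hne : (ν : ℕ) ≠ μ := fun h' => h (Fin.ext h')
    rw [Pi.single_eq_of_ne h, mul_zero, add_zero]
    have : ((ν : ℕ) < (μ : ℕ) + 1) ↔ ((ν : ℕ) < μ) := by omega
    simp only [this]

/-- Telescoping along the coordinates of the offset:
`B(blk p) − B(blk(p − q)) = Σ_μ (B(blk(p − pref q μ)) − B(blk(p − pref q (μ+1))))`. [folklore] -/
theorem telescope (n : ℕ) (Bf : X d → ℝ) (p q : X d) :
    Bf (blk n p) - Bf (blk n (p - q))
      = ∑ μ : Fin d, (Bf (blk n (p - pref q μ)) - Bf (blk n (p - pref q ((μ : ℕ) + 1)))) := by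
  have h := Fin.sum_univ_eq_sum_range
    (fun k => Bf (blk n (p - pref q k)) - Bf (blk n (p - pref q (k + 1)))) d
  rw [h, Finset.sum_range_sub', pref_zero, pref_of_le q le_rfl, sub_zero]

/-- Offsets in `{0,…,n}^d = B n 0` have coordinates in `[0, n]`. [folklore] -/
theorem mem_B_zero_bounds {n : ℕ} {q : X d} (hq : q ∈ B n (0 : X d)) (μ : Fin d) :
    0 ≤ q μ ∧ q μ ≤ n := by
  have hb := mem_B.1 hq
  have h := side_mul_blk_add_loc n q μ
  rw [hb] at h
  have : loc n q μ = q μ := by simpa using h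
  exact ⟨this ▸ loc_nonneg n q μ, this ▸ loc_le n q μ⟩

/-- One telescoping step is zero or one coarse bond (sliding window `blk_sub_smul`):
`(B(blk(p − pref q μ)) − B(blk(p − pref q (μ+1))))² ≤ g_μ(blk(p − pref q μ) − e_μ)`. [folklore] -/
theorem step_sq_le (n : ℕ) (Bf : X d → ℝ) (p q : X d) (μ : Fin d) (hq0 : 0 ≤ q μ) (hq : q μ ≤ n) :
    (Bf (blk n (p - pref q μ)) - Bf (blk n (p - pref q ((μ : ℕ) + 1)))) ^ 2
      ≤ gsq Bf μ (blk n (p - pref q μ) - e μ) := by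
  unfold gsq
  rw [sub_add_cancel, pref_succ, sub_add_eq_sub_sub]
  rcases blk_sub_smul n (p - pref q μ) μ hq0 hq with h | h
  · rw [h, sub_self, zero_pow two_ne_zero]; positivity
  · rw [h]; exact le_of_eq (by ring)

/-- Per pair `(p, q)`: `(B(blk p) − B(blk(p − q)))² ≤ d · Σ_μ g_μ(blk(p − pref q μ) − e_μ)`. [folklore] -/
theorem pair_sq_le (n : ℕ) (Bf : X d → ℝ) (p : X d) {q : X d} (hq : q ∈ B n (0 : X d)) :
    (Bf (blk n p) - Bf (blk n (p - q))) ^ 2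
      ≤ (d : ℝ) * ∑ μ : Fin d, gsq Bf μ (blk n (p - pref q μ) - e μ) := by
  rw [telescope n Bf p q]
  calc (∑ μ : Fin d, (Bf (blk n (p - pref q μ)) - Bf (blk n (p - pref q ((μ : ℕ) + 1))))) ^ 2
      ≤ ((Finset.univ : Finset (Fin d)).card : ℝ) *
          ∑ μ : Fin d, (Bf (blk n (p - pref q μ)) - Bf (blk n (p - pref q ((μ : ℕ) + 1)))) ^ 2 :=
        sq_sum_le _ _
    _ = (d : ℝ) * ∑ μ : Fin d, (Bf (blk n (p - pref q μ)) - Bf (blk n (p - pref q ((μ : ℕ) + 1)))) ^ 2 := by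
        rw [Finset.card_univ, Fintype.card_fin]
    _ ≤ (d : ℝ) * ∑ μ : Fin d, gsq Bf μ (blk n (p - pref q μ) - e μ) :=
        mul_le_mul_of_nonneg_left (Finset.sum_le_sum fun μ _ =>
          step_sq_le n Bf p q μ (mem_B_zero_bounds hq μ).1 (mem_B_zero_bounds hq μ).2) (by positivity)

/-- The finite set carrying the defect. [folklore] -/
def suppD (n : ℕ) (T : Finset (X d)) : Finset (X d) := T ∪ (suppA1 n T).image (blk n)

/-- The defect vanishes off `suppD`. [folklore] -/
theorem defect_eq_zero (n : ℕ) {T : Finset (X d)} {Bf : X d → ℝ} (hT : ∀ y ∉ T, Bf y = 0) {y : X d}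
    (hy : y ∉ suppD n T) : defect n Bf y = 0 := by
  classical
  have hyT : y ∉ T := fun h => hy (Finset.mem_union_left _ h)
  have hA : ∀ p ∈ B n y, A1 n Bf p = 0 := by
    intro p hp
    by_contra hne
    apply hy
    apply Finset.mem_union_right
    rw [Finset.mem_image]
    refine ⟨p, ?_, mem_B.1 hp⟩
    by_contra hp'
    exact hne (A1_eq_zero n hT hp')
  unfold defect
  rw [hT y hyT, Finset.sum_eq_zero hA, mul_zero, sub_zero]

/-- The defect is square summable (finitely supported). [folklore] -/
theorem summable_defect_sq (n : ℕ) {T : Finset (X d)} {Bf : X d → ℝ} (hT : ∀ y ∉ T, Bf y = 0) :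
    Summable fun y => defect n Bf y ^ 2 :=
  summable_of_ne_finset_zero (s := suppD n T) fun y hy => by simp [defect_eq_zero n hT hy]

/-- **Transport of the gradient profile**: for every offset `v`,
`Σ'_p g_μ(blk(p − v) − e_μ) = (n+1)^d Σ'_y g_μ(y)` (shift, block summation, shift). [folklore] -/
theorem tsum_transport (n : ℕ) {Bf : X d → ℝ} (hBf : Summable fun y => Bf y ^ 2) (μ : Fin d) (v : X d) :
    (Summable fun p : X d => gsq Bf μ (blk n (p - v) - e μ)) ∧
      ∑' p, gsq Bf μ (blk n (p - v) - e μ) = ((n : ℝ) + 1) ^ d * ∑' y, gsq Bf μ y := by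
  have hg : Summable (gsq Bf μ) := summable_grad_sq hBf μ
  have h1 : Summable fun y => gsq Bf μ (y - e μ) := summable_shift_sub hg (e μ)
  have hψ : Summable fun r : X d => gsq Bf μ (blk n r - e μ) :=
    summable_comp_blk n (G := fun y => gsq Bf μ (y - e μ)) h1 fun y => sq_nonneg _
  have hφ : Summable fun p : X d => gsq Bf μ (blk n (p - v) - e μ) :=
    summable_shift_sub (g := fun r => gsq Bf μ (blk n r - e μ)) hψ v
  refine ⟨hφ, ?_⟩
  calc ∑' p, gsq Bf μ (blk n (p - v) - e μ) = ∑' r, gsq Bf μ (blk n r - e μ) :=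
        tsum_shift_sub (fun r => gsq Bf μ (blk n r - e μ)) v
    _ = ∑' y, ∑ r ∈ B n y, gsq Bf μ (blk n r - e μ) := (tsum_blocks n hψ).symm
    _ = ∑' y, ((n : ℝ) + 1) ^ d * gsq Bf μ (y - e μ) := by
        refine tsum_congr fun y => ?_
        rw [← sum_B_const (n := n) y]
        exact Finset.sum_congr rfl fun r hr => by rw [mem_B.1 hr]
    _ = ((n : ℝ) + 1) ^ d * ∑' y, gsq Bf μ y := by
        rw [tsum_mul_left]
        congr 1
        exact tsum_shift_sub (gsq Bf μ) (e μ)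

/-- **The defect is `ℓ²`-small against the coarse energy**: `Σ'_y D(y)² ≤ d · energy B`. [folklore] -/
theorem tsum_defect_sq_le (n : ℕ) {T : Finset (X d)} (Bf : X d → ℝ) (hT : ∀ y ∉ T, Bf y = 0) :
    ∑' y, defect n Bf y ^ 2 ≤ (d : ℝ) * energy Bf := by
  classical
  have hBf := summable_sq_of_support hT
  have hN : ((n : ℝ) + 1) ^ d ≠ 0 := by positivity
  set Φ : X d → ℝ := fun p => ∑ q ∈ B n (0 : X d),
    ((d : ℝ) * ∑ μ : Fin d, gsq Bf μ (blk n (p - pref q μ) - e μ)) with hΦ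
  have hΦq : ∀ q ∈ B n (0 : X d), Summable fun p : X d =>
      (d : ℝ) * ∑ μ : Fin d, gsq Bf μ (blk n (p - pref q μ) - e μ) := fun q _ =>
    (summable_sum fun μ _ => (tsum_transport n hBf μ (pref q μ)).1).mul_left _
  have hΦs : Summable Φ := summable_sum hΦq
  have hΦt : ∑' p, Φ p = ((n : ℝ) + 1) ^ d * ((d : ℝ) * (((n : ℝ) + 1) ^ d * energy Bf)) := by
    rw [hΦ, Summable.tsum_finsetSum hΦq]
    have key : ∀ q ∈ B n (0 : X d), ∑' p, (d : ℝ) * ∑ μ : Fin d, gsq Bf μ (blk n (p - pref q μ) - e μ)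
        = (d : ℝ) * (((n : ℝ) + 1) ^ d * energy Bf) := by
      intro q _
      rw [tsum_mul_left, Summable.tsum_finsetSum (fun μ _ => (tsum_transport n hBf μ (pref q μ)).1)]
      congr 1
      rw [energy_eq_gsq, Finset.mul_sum]
      exact Finset.sum_congr rfl fun μ _ => (tsum_transport n hBf μ (pref q μ)).2
    rw [Finset.sum_congr rfl key, sum_B_const]
  have hpt : ∀ y, defect n Bf y ^ 2 ≤ (((n : ℝ) + 1) ^ d)⁻¹ ^ 2 * ∑ p ∈ B n y, Φ p := by
    intro y
    refine (defect_sq_le n Bf y).trans (mul_le_mul_of_nonneg_left ?_ (by positivity))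
    exact Finset.sum_le_sum fun p _ => Finset.sum_le_sum fun q hq => pair_sq_le n Bf p hq
  have hR : Summable fun y => (((n : ℝ) + 1) ^ d)⁻¹ ^ 2 * ∑ p ∈ B n y, Φ p :=
    (summable_blocks n hΦs).mul_left _
  calc ∑' y, defect n Bf y ^ 2 ≤ ∑' y, (((n : ℝ) + 1) ^ d)⁻¹ ^ 2 * ∑ p ∈ B n y, Φ p :=
        (summable_defect_sq n hT).tsum_le_tsum hpt hR
    _ = (((n : ℝ) + 1) ^ d)⁻¹ ^ 2 * ∑' p, Φ p := by rw [tsum_mul_left, tsum_blocks n hΦs]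
    _ = (d : ℝ) * energy Bf := by rw [hΦt]; field_simp

/-! ## §4  The bump correction: block means restored at energy cost `4d·(n+1)^{d−2}·Σ Λ²` [folklore] -/

/-- `Θ₁ > 0`. [folklore] -/
theorem Theta1_pos (n : ℕ) : 0 < Theta1 n := by
  rw [Theta1_eq]; positivity

/-- `(n+1)/Θ₁ ≤ 6` (from `Theta1_div_ge`: `Θ₁/(n+1) ≥ 1/6`). [folklore] -/
theorem side_div_Theta1_le (n : ℕ) : ((n : ℝ) + 1) / Theta1 n ≤ 6 := by
  have h := Theta1_div_ge n
  have hT := Theta1_pos n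
  rw [div_le_iff₀ hT]
  rw [le_div_iff₀ (by positivity)] at h
  linarith

/-- `((n+1)^d/Θ₁^d)² ≤ 36^d`. [folklore] -/
theorem ratio_sq_pow_le (n : ℕ) : (((n : ℝ) + 1) ^ d / Theta1 n ^ d) ^ 2 ≤ (36 : ℝ) ^ d := by
  have h0 : 0 ≤ ((n : ℝ) + 1) / Theta1 n := div_nonneg (by positivity) (Theta1_nonneg n)
  have h6 := side_div_Theta1_le n
  calc (((n : ℝ) + 1) ^ d / Theta1 n ^ d) ^ 2 = ((((n : ℝ) + 1) / Theta1 n) ^ 2) ^ d := by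
        rw [← div_pow, ← pow_mul, ← pow_mul, mul_comm]
    _ ≤ ((6 : ℝ) ^ 2) ^ d := pow_le_pow_left₀ (by positivity) (pow_le_pow_left₀ h0 h6 2) d
    _ = (36 : ℝ) ^ d := by norm_num

/-- **Block sums of the bump field**: `Σ_{p ∈ B(y)} F_Λ(p) = Λ(y)·Θ₁^d` (`sum_B_bump`). [folklore] -/
theorem sum_B_F (n : ℕ) (Λ : X d → ℝ) (y : X d) : ∑ p ∈ B n y, F n Λ p = Λ y * Theta1 n ^ d := by
  unfold F
  rw [← sum_B_bump n y, Finset.mul_sum]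
  exact Finset.sum_congr rfl fun p hp => by rw [mem_B.1 hp]

/-- `F_Λ(p)² ≤ Λ(blk p)²` (`0 ≤ bump ≤ 1`). [folklore] -/
theorem F_sq_le (n : ℕ) (Λ : X d → ℝ) (p : X d) : F n Λ p ^ 2 ≤ Λ (blk n p) ^ 2 := by
  unfold F
  rw [mul_pow]
  have h0 := bump_nonneg n p
  have h1 := bump_le_one n p
  have hb2 : bump n p ^ 2 ≤ 1 := by nlinarith
  calc Λ (blk n p) ^ 2 * bump n p ^ 2 ≤ Λ (blk n p) ^ 2 * 1 := mul_le_mul_of_nonneg_left hb2 (sq_nonneg _)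
    _ = Λ (blk n p) ^ 2 := mul_one _

/-- The bump field of a square-summable profile is square summable. [folklore] -/
theorem summable_F_sq (n : ℕ) {Λ : X d → ℝ} (hΛ : Summable fun y => Λ y ^ 2) :
    Summable fun p => F n Λ p ^ 2 :=
  Summable.of_nonneg_of_le (fun _ => sq_nonneg _) (F_sq_le n Λ)
    (summable_comp_blk n (G := fun y => Λ y ^ 2) hΛ fun _ => sq_nonneg _)

/-- `Σ'_p Λ(blk p)² = (n+1)^d Σ'_y Λ(y)²`. [folklore] -/
theorem tsum_sq_blk (n : ℕ) {Λ : X d → ℝ} (hΛ : Summable fun y => Λ y ^ 2) :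
    ∑' p : X d, Λ (blk n p) ^ 2 = ((n : ℝ) + 1) ^ d * ∑' y, Λ y ^ 2 := by
  have hΛb : Summable fun p : X d => Λ (blk n p) ^ 2 :=
    summable_comp_blk n (G := fun y => Λ y ^ 2) hΛ fun y => sq_nonneg _
  rw [← tsum_blocks n hΛb, ← tsum_mul_left]
  refine tsum_congr fun y => ?_
  rw [← sum_B_const (n := n) y]
  exact Finset.sum_congr rfl fun p hp => by rw [mem_B.1 hp]

/-- **The Dirichlet energy of the bump field, one direction** (`F_step_sq`):
`(n+1)²·Σ'_p (F_Λ(p) − F_Λ(p+e_μ))² ≤ 4·(n+1)^d·Σ'_y Λ(y)²`. [folklore] -/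
theorem dir_energy_F_le (n : ℕ) {Λ : X d → ℝ} (hΛ : Summable fun y => Λ y ^ 2) (μ : Fin d) :
    ((n : ℝ) + 1) ^ 2 * ∑' p, (F n Λ p - F n Λ (p + e μ)) ^ 2
      ≤ 4 * ((n : ℝ) + 1) ^ d * ∑' y, Λ y ^ 2 := by
  have hN : (0 : ℝ) < (n : ℝ) + 1 := by positivity
  have hΛb : Summable fun p : X d => Λ (blk n p) ^ 2 :=
    summable_comp_blk n (G := fun y => Λ y ^ 2) hΛ fun y => sq_nonneg _
  have hΛb' : Summable fun p : X d => Λ (blk n (p + e μ)) ^ 2 :=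
    summable_shift (g := fun p => Λ (blk n p) ^ 2) hΛb (e μ)
  have hL : Summable fun p => (F n Λ p - F n Λ (p + e μ)) ^ 2 := summable_grad_sq (summable_F_sq n hΛ) μ
  have hR : Summable fun p => 2 * (Λ (blk n p) ^ 2 + Λ (blk n (p + e μ)) ^ 2) / ((n : ℝ) + 1) ^ 2 :=
    ((hΛb.add hΛb').mul_left 2).div_const _
  have hsum := tsum_sq_blk n hΛ
  have hsum' : ∑' p : X d, Λ (blk n (p + e μ)) ^ 2 = ((n : ℝ) + 1) ^ d * ∑' y, Λ y ^ 2 := by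
    rw [← hsum]; exact tsum_shift (fun p => Λ (blk n p) ^ 2) (e μ)
  calc ((n : ℝ) + 1) ^ 2 * ∑' p, (F n Λ p - F n Λ (p + e μ)) ^ 2
      ≤ ((n : ℝ) + 1) ^ 2 * ∑' p, 2 * (Λ (blk n p) ^ 2 + Λ (blk n (p + e μ)) ^ 2) / ((n : ℝ) + 1) ^ 2 :=
        mul_le_mul_of_nonneg_left (hL.tsum_le_tsum (fun p => F_step_sq n Λ p μ) hR) (by positivity)
    _ = 4 * ((n : ℝ) + 1) ^ d * ∑' y, Λ y ^ 2 := by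
        rw [tsum_div_const, tsum_mul_left, hΛb.tsum_add hΛb', hsum, hsum']
        field_simp
        ring

/-! ## §5  The competitor `A = A₁ + F_Λ`, minimality of `H_kB`, and (1.67) right half
[print-located; proved outright] -/

/-- The correction profile `Λ = ((n+1)/Θ₁)^d · D`: chosen so that `Q′F_Λ = D` exactly. [folklore] -/
def Lam (n : ℕ) (Bf : X d → ℝ) (y : X d) : ℝ := ((n : ℝ) + 1) ^ d / Theta1 n ^ d * defect n Bf y

/-- **The competitor** `A = A₁ + F_Λ`: an explicit, finitely supported, Fourier-free right inverse of the block
averaging applied to `B` (`Q′A = B`, `sum_B_competitor`). [folklore] -/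
def competitor (n : ℕ) (Bf : X d → ℝ) (p : X d) : ℝ := A1 n Bf p + F n (Lam n Bf) p

/-- **`Q′A = B`**: `Σ_{p ∈ B(y)} A(p) = (n+1)^d·B(y)` for every `y`. [folklore] -/
theorem sum_B_competitor (n : ℕ) (Bf : X d → ℝ) (y : X d) :
    ∑ p ∈ B n y, competitor n Bf p = ((n : ℝ) + 1) ^ d * Bf y := by
  have hTd : Theta1 n ^ d ≠ 0 := by have := Theta1_pos n; positivity
  have hN : ((n : ℝ) + 1) ^ d ≠ 0 := by positivity
  unfold competitor
  rw [Finset.sum_add_distrib, sum_B_F]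
  unfold Lam defect
  field_simp
  ring

/-- `Λ` is square summable. [folklore] -/
theorem summable_Lam_sq (n : ℕ) {T : Finset (X d)} {Bf : X d → ℝ} (hT : ∀ y ∉ T, Bf y = 0) :
    Summable fun y => Lam n Bf y ^ 2 := by
  unfold Lam
  exact summable_sq_smul _ (summable_defect_sq n hT)

/-- `Σ'_y Λ(y)² ≤ 36^d · d · energy B`. [folklore] -/
theorem tsum_Lam_sq_le (n : ℕ) {T : Finset (X d)} (Bf : X d → ℝ) (hT : ∀ y ∉ T, Bf y = 0) :
    ∑' y, Lam n Bf y ^ 2 ≤ (36 : ℝ) ^ d * ((d : ℝ) * energy Bf) := by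
  have h1 : ∑' y, Lam n Bf y ^ 2 = (((n : ℝ) + 1) ^ d / Theta1 n ^ d) ^ 2 * ∑' y, defect n Bf y ^ 2 := by
    unfold Lam
    rw [← tsum_mul_left]
    exact tsum_congr fun y => by ring
  rw [h1]
  have hE : 0 ≤ (d : ℝ) * energy Bf :=
    le_trans (tsum_nonneg fun y => sq_nonneg _) (tsum_defect_sq_le n Bf hT)
  exact mul_le_mul (ratio_sq_pow_le n) (tsum_defect_sq_le n Bf hT) (tsum_nonneg fun y => sq_nonneg _)
    (by positivity)

/-- The competitor is square summable. [folklore] -/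
theorem summable_competitor_sq (n : ℕ) {T : Finset (X d)} {Bf : X d → ℝ} (hT : ∀ y ∉ T, Bf y = 0) :
    Summable fun p => competitor n Bf p ^ 2 := by
  unfold competitor
  exact summable_sq_add (summable_A1_sq n hT) (summable_F_sq n (summable_Lam_sq n hT))

/-- **The energy of the competitor**: `(n+1)²·energy A ≤ (2 + 8d²·36^d)·(n+1)^d·energy B`. [folklore] -/
theorem energy_competitor_le (n : ℕ) {T : Finset (X d)} (Bf : X d → ℝ) (hT : ∀ y ∉ T, Bf y = 0) :
    ((n : ℝ) + 1) ^ 2 * energy (competitor n Bf)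
      ≤ (2 + 8 * (d : ℝ) ^ 2 * (36 : ℝ) ^ d) * (((n : ℝ) + 1) ^ d * energy Bf) := by
  have hΛ : Summable fun y => Lam n Bf y ^ 2 := summable_Lam_sq n hT
  have hA : ∀ μ, Summable fun p => (A1 n Bf p - A1 n Bf (p + e μ)) ^ 2 := fun μ =>
    summable_grad_sq (summable_A1_sq n hT) μ
  have hF : ∀ μ, Summable fun p => (F n (Lam n Bf) p - F n (Lam n Bf) (p + e μ)) ^ 2 := fun μ =>
    summable_grad_sq (summable_F_sq n hΛ) μ
  have hC : ∀ μ, Summable fun p => (competitor n Bf p - competitor n Bf (p + e μ)) ^ 2 := fun μ =>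
    summable_grad_sq (summable_competitor_sq n hT) μ
  have hdir : ∀ μ : Fin d, ((n : ℝ) + 1) ^ 2 * ∑' p, (competitor n Bf p - competitor n Bf (p + e μ)) ^ 2
      ≤ 2 * (((n : ℝ) + 1) ^ d * ∑' y, (Bf y - Bf (y + e μ)) ^ 2)
        + 2 * (4 * ((n : ℝ) + 1) ^ d * ∑' y, Lam n Bf y ^ 2) := by
    intro μ
    have hpt : ∀ p, (competitor n Bf p - competitor n Bf (p + e μ)) ^ 2
        ≤ 2 * (A1 n Bf p - A1 n Bf (p + e μ)) ^ 2
          + 2 * (F n (Lam n Bf) p - F n (Lam n Bf) (p + e μ)) ^ 2 := by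
      intro p
      unfold competitor
      rw [show A1 n Bf p + F n (Lam n Bf) p - (A1 n Bf (p + e μ) + F n (Lam n Bf) (p + e μ))
          = (A1 n Bf p - A1 n Bf (p + e μ)) + (F n (Lam n Bf) p - F n (Lam n Bf) (p + e μ)) from by ring]
      nlinarith [sq_nonneg ((A1 n Bf p - A1 n Bf (p + e μ)) - (F n (Lam n Bf) p - F n (Lam n Bf) (p + e μ)))]
    have h1 := (hC μ).tsum_le_tsum hpt (((hA μ).mul_left 2).add ((hF μ).mul_left 2))
    rw [((hA μ).mul_left 2).tsum_add ((hF μ).mul_left 2), tsum_mul_left, tsum_mul_left] at h1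
    have h2 := dir_energy_A1_le n Bf hT μ
    have h3 := dir_energy_F_le n hΛ μ
    calc ((n : ℝ) + 1) ^ 2 * ∑' p, (competitor n Bf p - competitor n Bf (p + e μ)) ^ 2
        ≤ ((n : ℝ) + 1) ^ 2 * (2 * ∑' p, (A1 n Bf p - A1 n Bf (p + e μ)) ^ 2
            + 2 * ∑' p, (F n (Lam n Bf) p - F n (Lam n Bf) (p + e μ)) ^ 2) :=
          mul_le_mul_of_nonneg_left h1 (by positivity)
      _ = 2 * (((n : ℝ) + 1) ^ 2 * ∑' p, (A1 n Bf p - A1 n Bf (p + e μ)) ^ 2)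
            + 2 * (((n : ℝ) + 1) ^ 2 * ∑' p, (F n (Lam n Bf) p - F n (Lam n Bf) (p + e μ)) ^ 2) := by
          ring
      _ ≤ 2 * (((n : ℝ) + 1) ^ d * ∑' y, (Bf y - Bf (y + e μ)) ^ 2)
            + 2 * (4 * ((n : ℝ) + 1) ^ d * ∑' y, Lam n Bf y ^ 2) :=
          add_le_add (mul_le_mul_of_nonneg_left h2 zero_le_two) (mul_le_mul_of_nonneg_left h3 zero_le_two)
  have hL := tsum_Lam_sq_le n Bf hT
  unfold energy
  rw [Finset.mul_sum]
  calc ∑ μ : Fin d, ((n : ℝ) + 1) ^ 2 * ∑' p, (competitor n Bf p - competitor n Bf (p + e μ)) ^ 2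
      ≤ ∑ μ : Fin d, (2 * (((n : ℝ) + 1) ^ d * ∑' y, (Bf y - Bf (y + e μ)) ^ 2)
          + 2 * (4 * ((n : ℝ) + 1) ^ d * ∑' y, Lam n Bf y ^ 2)) := Finset.sum_le_sum fun μ _ => hdir μ
    _ = 2 * (((n : ℝ) + 1) ^ d * ∑ μ : Fin d, ∑' y, (Bf y - Bf (y + e μ)) ^ 2)
          + 8 * ((d : ℝ) * ((n : ℝ) + 1) ^ d * ∑' y, Lam n Bf y ^ 2) := by
        rw [Finset.sum_add_distrib, Finset.sum_const, Finset.card_univ, Fintype.card_fin, nsmul_eq_mul,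
          ← Finset.mul_sum, ← Finset.mul_sum]
        ring
    _ ≤ 2 * (((n : ℝ) + 1) ^ d * ∑ μ : Fin d, ∑' y, (Bf y - Bf (y + e μ)) ^ 2)
          + 8 * ((d : ℝ) * ((n : ℝ) + 1) ^ d * ((36 : ℝ) ^ d * ((d : ℝ) * energy Bf))) := by
        have := mul_le_mul_of_nonneg_left hL (by positivity : (0 : ℝ) ≤ (d : ℝ) * ((n : ℝ) + 1) ^ d)
        linarith
    _ = (2 + 8 * (d : ℝ) ^ 2 * (36 : ℝ) ^ d) *
          (((n : ℝ) + 1) ^ d * ∑ μ : Fin d, ∑' y, (Bf y - Bf (y + e μ)) ^ 2) := by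
        unfold energy
        ring

/-- **OUR explicit constant for the right half of (1.67), depending on `d` only**: `γ₁(d) = 2 + 8d²·36^d`
(the paper prints no value; ours is far from optimal; `0 < γ₁` by `unfold gamma1; positivity`). [folklore] -/
def gamma1 (d : ℕ) : ℝ := 2 + 8 * (d : ℝ) ^ 2 * 36 ^ d

/-- In `d = 1`, `γ₁ = 290`. [folklore] -/
example : gamma1 1 = 290 := by norm_num [gamma1]

/-- **The variational bound at the explicit competitor** (η-normalisation):
`(n+1)²·energy(H_kB) ≤ γ₁(d)·(n+1)^d·energy B` — global minimality of `H_kB` (node 7, `energy_HB_le`) tested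
against `A = A₁ + F_Λ`. [folklore] -/
theorem energy_HB_le_gamma1 (n : ℕ) {a : ℝ} (ha : 0 < a) (T : Finset (X d)) (Bf : X d → ℝ)
    (hT : ∀ y ∉ T, Bf y = 0) :
    ((n : ℝ) + 1) ^ 2 * energy (HB n a T Bf) ≤ gamma1 d * (((n : ℝ) + 1) ^ d * energy Bf) := by
  have hA2 : Summable fun p => (competitor n Bf p - HB n a T Bf p) ^ 2 :=
    summable_sq_sub (summable_competitor_sq n hT) (summable_HB_sq n ha T Bf)
  have hmin := energy_HB_le n ha T Bf hT (competitor n Bf) hA2 (sum_B_competitor n Bf)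
  calc ((n : ℝ) + 1) ^ 2 * energy (HB n a T Bf) ≤ ((n : ℝ) + 1) ^ 2 * energy (competitor n Bf) :=
        mul_le_mul_of_nonneg_left hmin (by positivity)
    _ ≤ gamma1 d * (((n : ℝ) + 1) ^ d * energy Bf) := energy_competitor_le n Bf hT

/-- **(1.67), RIGHT HALF, scalar, whole lattice `ℤ^d`, `γ₁ = γ₁(d)` explicit and depending on `d` only**:
`⟨B, Δ_kB⟩ ≤ γ₁⟨∂₁B, ∂₁B⟩`, i.e. `actionForm n a T B ≤ γ₁(d)·energy B` for every coarse field `B` supported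
in the finset `T`, every block side `n + 1 ≥ 1` and every `a > 0` — via (1.65) `(n+1)²·energy(H_kB) =
(n+1)^d·actionForm` (node 8, `energy_HB_eq'`) and `energy_HB_le_gamma1`. [cite: Balaban1984PropagatorsI, (1.67) p.29] -/
theorem ineq167_upper_scalar (n : ℕ) {a : ℝ} (ha : 0 < a) (T : Finset (X d)) (Bf : X d → ℝ)
    (hT : ∀ y ∉ T, Bf y = 0) : actionForm n a T Bf ≤ gamma1 d * energy Bf := by
  have hN : (0 : ℝ) < ((n : ℝ) + 1) ^ d := by positivity
  have h := energy_HB_le_gamma1 n ha T Bf hT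
  rw [energy_HB_eq' n ha T Bf hT, mul_left_comm] at h
  exact le_of_mul_le_mul_left h hN

/-- **(1.67) IN FULL, scalar, whole lattice `ℤ^d`**: `⟨∂₁B,∂₁B⟩ ≤ ⟨B, Δ_kB⟩ ≤ γ₁(d)·⟨∂₁B,∂₁B⟩` with `γ₀ = 1`
(node 9, `ineq167_lower_scalar`) and `γ₁ = γ₁(d) = 2 + 8d²·36^d` (this file) — «positive constants γ₀, γ₁
dependent on d only», uniformly in the step `n` (i.e. in `k`), in `a > 0` and in the (finite) support of `B`.
[cite: Balaban1984PropagatorsI, (1.67) p.29] -/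
theorem ineq167_scalar (n : ℕ) {a : ℝ} (ha : 0 < a) (T : Finset (X d)) (Bf : X d → ℝ)
    (hT : ∀ y ∉ T, Bf y = 0) :
    energy Bf ≤ actionForm n a T Bf ∧ actionForm n a T Bf ≤ gamma1 d * energy Bf :=
  ⟨ineq167_lower_scalar n ha T Bf hT, ineq167_upper_scalar n ha T Bf hT⟩

/-- The printed shape «∃ γ₀, γ₁ > 0 depending on d only» for the scalar `ℤ^d` form, as a closed statement over all
steps, dummies `a > 0` and finitely supported coarse fields. [cite: Balaban1984PropagatorsI, (1.67) p.29] -/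
theorem ineq167_scalar_exists (d : ℕ) :
    ∃ γ₀ γ₁ : ℝ, 0 < γ₀ ∧ 0 < γ₁ ∧ ∀ (n : ℕ) (a : ℝ), 0 < a → ∀ (T : Finset (X d)) (Bf : X d → ℝ),
      (∀ y ∉ T, Bf y = 0) →
        γ₀ * energy Bf ≤ actionForm n a T Bf ∧ actionForm n a T Bf ≤ γ₁ * energy Bf :=
  ⟨1, gamma1 d, one_pos, by unfold gamma1; positivity, fun n _a ha T Bf hT => by
    rw [one_mul]; exact ineq167_scalar n ha T Bf hT⟩

end

end Literature.MathematicalPhysics.QuantumFieldTheory.Balaban1983to89.B5Ineq167UpperZd
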